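import Literature.Analysis.FluidPDE.Seregin2020ScaledEnergyBounds
import HarnessLib

/-!
# The local energy estimate in product form `A(θR) + E(θR) ≲ θ²C^{2/3} + θ⁻²(AE)^{1/2}C^{1/3} + θ⁻²D^{2/3}C^{1/3}`,
# at every scale and at cylinders touching the top of the domain

Analysis/FluidPDE proof file (everything proved; no definitions, no named facts), third file of
the bottom-up discharge of
`Literature.Analysis.FluidPDE.Seregin2020_axisymmetricSingularPoint_typeII` (G. Seregin,
Anal. Math. Phys. 10 (2020) = arXiv:2006.04140, Thm. 2.1), serving the case `limsup E < ∞` of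
the remark following Def. 1.7 ("`g(z₀) < ∞ ⇒ G(z₀) < ∞`", after Seregin 2006). In that case the
cubic term of the local energy inequality must be kept in the mean-subtracted, product form

  `A(R/2) + E(R/2) ≤ c [C(R)^{2/3} + A(R)^{1/2} E(R)^{1/2} C(R)^{1/3} + D(R)^{2/3} C(R)^{1/3}]`

(Seregin 2014, Lemma 6.3, (6.1.36); Robinson–Rodrigo–Sadowski 2016, (16.6)), because the crude
bound `θ⁻² C(R)` of `localEnergyBound` (`CKNLocalEnergyBound.lean`) is superlinear in the
functional `A^{3/2}` of the iteration. The tree proves exactly this form at unit scale with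
finiteness hypotheses, `localEnergy_master` (`CKNLocalEnergyEstimate.lean`); this file

* removes the finiteness hypotheses (`localEnergyProduct_unitScale`; they follow from
  `closure Q₁ ⊆ Q` as in `localEnergyBound_unitScale`),
* transports the estimate to every centre and scale by the Navier–Stokes scaling
  (`localEnergyProduct`, as `localEnergyBound`), and
* passes to cylinders `Q_R(z) ⊆ Q` touching the top of the domain at the ratio `θ = 1/2`
  (`localEnergyProduct_top`, unforced, `ν = 1`), by the inner approximation of
  `CKNInnerCylinders.lean` exactly as in `Seregin2020.localEnergyBound_top`
  (`Seregin2020ScaledEnergyBounds.lean`): the data `A, E, C, D` of the inner cylinders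
  `Q_{σₙR}(t - δₙ, x)`, `σₙ ≥ 1/2`, are at most `2, 2, 4, 4` times those of `Q_R(t, x)`.

## References

* G. Seregin, *Lecture Notes on Regularity Theory for the Navier–Stokes Equations* (2014),
  Lemma 6.3, (6.1.36)–(6.1.37). [`Seregin2014`]
* J. C. Robinson, J. L. Rodrigo, W. Sadowski, *The three-dimensional Navier–Stokes equations*
  (2016), proof of Thm. 16.1, (16.6) and p. 241. [`RobinsonRodrigoSadowski2016`]
* G. Seregin, Anal. Math. Phys. 10 (2020), Paper 46: remark after Def. 1.7. [`Seregin2020`]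
* T.-P. Tsai, Arch. Rational Mech. Anal. 143 (1998), remark after Lemma 4.2. [`Tsai1998`]
-/

noncomputable section

open MeasureTheory Set Function Filter Topology TopologicalSpace Metric
open scoped NNReal ENNReal

namespace Literature.Analysis.FluidPDE

namespace Seregin2020

/-! ### Unit scale, finiteness derived -/

/-- **The local energy estimate in product form at unit scale** (Seregin 2014, (6.1.36);
Robinson–Rodrigo–Sadowski 2016, (16.6)): there are absolute `k₁, …, k₄` such that for every
suitable weak solution (`ν = 1`) with force `f ∈ L^q(Q)`, `q > 5/2`, every weak
spatial gradient `G`, `closure Q₁(0) ⊆ Q` and `0 < θ ≤ 1/2`,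
`A(θ) + E(θ) ≤ k₁ θ² C(1)^{2/3} + k₂ θ⁻² (A(1)E(1))^{1/2} C(1)^{1/3} + k₃ θ⁻² D(1)^{2/3} C(1)^{1/3}
  + k₄ θ⁻¹ F_q(1)^{1/q} C(1)^{1/3}`
(the tree's `localEnergy_master`, whose finiteness hypotheses follow from `closure Q₁ ⊆ Q`).
[cite: Seregin2014, Lemma 6.3 (6.1.36)] -/
theorem localEnergyProduct_unitScale :
    ∃ k₁ k₂ k₃ k₄ : ℝ≥0, ∀ (Q : Opens (ℝ × EuclideanSpace ℝ (Fin 3))) (q : ℝ)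
      (f u : ℝ → EuclideanSpace ℝ (Fin 3) → EuclideanSpace ℝ (Fin 3))
      (p : ℝ → EuclideanSpace ℝ (Fin 3) → ℝ)
      (G : ℝ → EuclideanSpace ℝ (Fin 3) → EuclideanSpace ℝ (Fin 3) →L[ℝ] EuclideanSpace ℝ (Fin 3)),
      IsSuitableWeakSolutionOn Q 1 f u p → 5 / 2 < q →
      MemLp (uncurry f) (ENNReal.ofReal q)
        (volume.restrict (Q : Set (ℝ × EuclideanSpace ℝ (Fin 3)))) →
      HasWeakSpatialGradientOn Q u G →
      closure (parabolicCylinder 1 (0 : ℝ × EuclideanSpace ℝ (Fin 3))) ⊆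
        (Q : Set (ℝ × EuclideanSpace ℝ (Fin 3))) →
      ∀ θ : ℝ, 0 < θ → θ ≤ 1 / 2 →
        cknAEss θ 0 u + cknE θ 0 G ≤
          k₁ * ENNReal.ofReal (θ ^ 2) * cknC 1 0 u ^ (2 / 3 : ℝ) +
          k₂ * ENNReal.ofReal ((θ ^ 2)⁻¹) * (cknAEss 1 0 u * cknE 1 0 G) ^ (1 / 2 : ℝ) *
            cknC 1 0 u ^ (1 / 3 : ℝ) +
          k₃ * ENNReal.ofReal ((θ ^ 2)⁻¹) * cknD 1 0 p ^ (2 / 3 : ℝ) * cknC 1 0 u ^ (1 / 3 : ℝ) +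
          k₄ * ENNReal.ofReal θ⁻¹ * cknF q 1 0 f ^ (1 / q) * cknC 1 0 u ^ (1 / 3 : ℝ) := by
  obtain ⟨cT, c1, C4, c2, hcT, hc1, hC4, hc2, hM⟩ := localEnergy_master
  obtain ⟨C0, hC0⟩ := exists_cknC_le_rpow
  set cν : ℝ := 2 * cT with hcν
  have hcν0 : 0 ≤ cν := by positivity
  refine ⟨Real.toNNReal (cν * (cT * c1)), Real.toNNReal (cν * (cT * C4)),
    Real.toNNReal (cν * (2 * cT)), Real.toNNReal (cν * (2 * cT * c2)),
    fun Q q f u p G hsol hq hf hG hcl θ hθ hθ2 => ?_⟩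
  have hq0 : 0 < q := by linarith
  -- finiteness
  have hle : parabolicCylinderOpens 1 (0 : ℝ × EuclideanSpace ℝ (Fin 3)) ≤ Q := by
    intro z hz
    have hz' : z ∈ parabolicCylinder 1 (0 : ℝ × EuclideanSpace ℝ (Fin 3)) := by
      rwa [← coe_parabolicCylinderOpens]
    exact hcl (subset_closure hz')
  have hA := hsol.cknAEss_one_ne_top hcl
  have hE := hsol.cknE_one_ne_top hG hcl
  have hD := hsol.cknD_one_ne_top hcl
  have hF : cknF q 1 0 f ≠ ∞ := cknF_one_ne_top_of_memLp hq0 hf (subset_closure.trans hcl)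
  have hCle : cknC 1 0 u ≤ C0 * (cknAEss 1 0 u + cknE 1 0 G) ^ (3 / 2 : ℝ) :=
    hC0 u G 0 1 one_pos (hG.mono hle) hA hE
  have hC : cknC 1 0 u ≠ ∞ :=
    ne_top_of_le_ne_top (ENNReal.mul_ne_top ENNReal.coe_ne_top
      (ENNReal.rpow_ne_top_of_nonneg (by norm_num) (ENNReal.add_ne_top.2 ⟨hA, hE⟩))) hCle
  have key := hM Q q f u p G hsol hq hf hG hcl hA hE hC hD hF θ hθ hθ2
  refine key.trans (le_of_eq ?_)
  have e1 : (Real.toNNReal (cν * (cT * c1)) : ℝ≥0∞) = ENNReal.ofReal (cν * (cT * c1)) := rfl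
  have e2 : (Real.toNNReal (cν * (cT * C4)) : ℝ≥0∞) = ENNReal.ofReal (cν * (cT * C4)) := rfl
  have e3 : (Real.toNNReal (cν * (2 * cT)) : ℝ≥0∞) = ENNReal.ofReal (cν * (2 * cT)) := rfl
  have e4 : (Real.toNNReal (cν * (2 * cT * c2)) : ℝ≥0∞) =
      ENNReal.ofReal (cν * (2 * cT * c2)) := rfl
  rw [e1, e2, e3, e4, mul_add, mul_add, mul_add]
  have hθ0 : 0 ≤ θ ^ 2 := sq_nonneg θ
  have hθi2 : 0 ≤ (θ ^ 2)⁻¹ := inv_nonneg.2 hθ0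
  have hθi : 0 ≤ θ⁻¹ := inv_nonneg.2 hθ.le
  have t1 : ENNReal.ofReal cν * (ENNReal.ofReal (cT * θ ^ 2 * c1) * cknC 1 0 u ^ (2 / 3 : ℝ)) =
      ENNReal.ofReal (cν * (cT * c1)) * ENNReal.ofReal (θ ^ 2) * cknC 1 0 u ^ (2 / 3 : ℝ) := by
    rw [← mul_assoc, ← ENNReal.ofReal_mul hcν0, ← ENNReal.ofReal_mul (by positivity)]
    congr 2; ring
  have t2 : ENNReal.ofReal cν * (ENNReal.ofReal (cT * C4 * (θ ^ 2)⁻¹) *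
      (cknAEss 1 0 u * cknE 1 0 G) ^ (1 / 2 : ℝ) * cknC 1 0 u ^ (1 / 3 : ℝ)) =
      ENNReal.ofReal (cν * (cT * C4)) * ENNReal.ofReal ((θ ^ 2)⁻¹) *
        (cknAEss 1 0 u * cknE 1 0 G) ^ (1 / 2 : ℝ) * cknC 1 0 u ^ (1 / 3 : ℝ) := by
    rw [← mul_assoc, ← mul_assoc, ← ENNReal.ofReal_mul hcν0, ← ENNReal.ofReal_mul (by positivity)]
    congr 3; ring
  have t3 : ENNReal.ofReal cν * (ENNReal.ofReal (2 * cT * (θ ^ 2)⁻¹) * cknD 1 0 p ^ (2 / 3 : ℝ) *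
      cknC 1 0 u ^ (1 / 3 : ℝ)) =
      ENNReal.ofReal (cν * (2 * cT)) * ENNReal.ofReal ((θ ^ 2)⁻¹) * cknD 1 0 p ^ (2 / 3 : ℝ) *
        cknC 1 0 u ^ (1 / 3 : ℝ) := by
    rw [← mul_assoc, ← mul_assoc, ← ENNReal.ofReal_mul hcν0, ← ENNReal.ofReal_mul (by positivity)]
    congr 3; ring
  have t4 : ENNReal.ofReal cν * (ENNReal.ofReal (2 * cT * c2 * θ⁻¹) * cknF q 1 0 f ^ (1 / q) *
      cknC 1 0 u ^ (1 / 3 : ℝ)) =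
      ENNReal.ofReal (cν * (2 * cT * c2)) * ENNReal.ofReal θ⁻¹ * cknF q 1 0 f ^ (1 / q) *
        cknC 1 0 u ^ (1 / 3 : ℝ) := by
    have hc2' : 0 ≤ c2 := by linarith
    rw [← mul_assoc, ← mul_assoc, ← ENNReal.ofReal_mul hcν0, ← ENNReal.ofReal_mul (by positivity)]
    congr 3; ring
  rw [t1, t2, t3, t4]

/-! ### Every centre and scale -/

/-- **The local energy estimate in product form at two scales** (Seregin 2014, Lemma 6.3,
(6.1.36), in the backward-cylinder vocabulary of Caffarelli–Kohn–Nirenberg): there are absolute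
constants `k₁, …, k₄` such that for every suitable weak solution `(u, p)` (`ν = 1`) with force
`f ∈ L^q(Q)`, `q > 5/2`, every weak spatial gradient `G`
of `u` on `Q`, every cylinder with `closure Q_R(z) ⊆ Q` and every `0 < θ ≤ 1/2`,
`A(θR) + E(θR) ≤ k₁ θ² C(R)^{2/3} + k₂ θ⁻² (A(R)E(R))^{1/2} C(R)^{1/3} + k₃ θ⁻² D(R)^{2/3} C(R)^{1/3}
  + k₄ θ⁻¹ F_q(R)^{1/q} C(R)^{1/3}`. From the unit-scale estimate by the Navier–Stokes
scaling. [cite: Seregin2014, Lemma 6.3 (6.1.36)] -/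
theorem localEnergyProduct :
    ∃ k₁ k₂ k₃ k₄ : ℝ≥0, ∀ (Q : Opens (ℝ × EuclideanSpace ℝ (Fin 3))) (q : ℝ)
      (f u : ℝ → EuclideanSpace ℝ (Fin 3) → EuclideanSpace ℝ (Fin 3))
      (p : ℝ → EuclideanSpace ℝ (Fin 3) → ℝ)
      (G : ℝ → EuclideanSpace ℝ (Fin 3) → EuclideanSpace ℝ (Fin 3) →L[ℝ] EuclideanSpace ℝ (Fin 3)),
      IsSuitableWeakSolutionOn Q 1 f u p → 5 / 2 < q →
      MemLp (uncurry f) (ENNReal.ofReal q)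
        (volume.restrict (Q : Set (ℝ × EuclideanSpace ℝ (Fin 3)))) →
      HasWeakSpatialGradientOn Q u G →
      ∀ (z : ℝ × EuclideanSpace ℝ (Fin 3)) (R θ : ℝ), 0 < R → 0 < θ → θ ≤ 1 / 2 →
        closure (parabolicCylinder R z) ⊆ (Q : Set (ℝ × EuclideanSpace ℝ (Fin 3))) →
        cknAEss (θ * R) z u + cknE (θ * R) z G ≤
          k₁ * ENNReal.ofReal (θ ^ 2) * cknC R z u ^ (2 / 3 : ℝ) +
          k₂ * ENNReal.ofReal ((θ ^ 2)⁻¹) * (cknAEss R z u * cknE R z G) ^ (1 / 2 : ℝ) *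
            cknC R z u ^ (1 / 3 : ℝ) +
          k₃ * ENNReal.ofReal ((θ ^ 2)⁻¹) * cknD R z p ^ (2 / 3 : ℝ) * cknC R z u ^ (1 / 3 : ℝ) +
          k₄ * ENNReal.ofReal θ⁻¹ * cknF q R z f ^ (1 / q) * cknC R z u ^ (1 / 3 : ℝ) := by
  obtain ⟨k₁, k₂, k₃, k₄, H⟩ := localEnergyProduct_unitScale
  refine ⟨k₁, k₂, k₃, k₄, fun Q q f u p G hsol hq hf hG z r θ hr hθ hθ' hcl => ?_⟩
  have hq0 : 0 ≤ q := by linarith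
  -- the zoomed data
  set Q' := stPreimage (r ^ 2) r z.1 z.2 Q with hQ'
  set u' := r • stPull (r ^ 2) r z.1 z.2 u with hu'
  set p' := r ^ 2 • stPull (r ^ 2) r z.1 z.2 p with hp'
  set f' := r ^ 3 • stPull (r ^ 2) r z.1 z.2 f with hf'
  set G' := r ^ 2 • stPull (r ^ 2) r z.1 z.2 G with hG'
  have hsol' : IsSuitableWeakSolutionOn Q' 1 f' u' p' := by
    have := hsol.stRescale (α := r) (β := r ^ 2) (γ := r) hr hr (by ring) z.1 z.2
    rwa [show r * 1 / r = 1 by field_simp, show r ^ 2 * r = r ^ 3 by ring] at this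
  have hf'' : MemLp (uncurry f') (ENNReal.ofReal q)
      (volume.restrict (Q' : Set (ℝ × EuclideanSpace ℝ (Fin 3)))) :=
    hf.smul_uncurry_stPull (by positivity) hr z.1 z.2 (r ^ 3)
  have hG'' : HasWeakSpatialGradientOn Q' u' G' := by
    have := hG.stRescale r (by positivity : 0 < r ^ 2) hr z.1 z.2
    rwa [← sq] at this
  have hcl' := closure_parabolicCylinder_one_subset_stPreimage hr hcl
  have key := H Q' q f' u' p' G' hsol' hq hf'' hG'' hcl' θ hθ hθ'
  -- transport the quantities back
  have hz : stAffine (r ^ 2) r z.1 z.2 (0 : ℝ × EuclideanSpace ℝ (Fin 3)) = z :=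
    Prod.ext (by simp [stAffine]) (by simp [stAffine])
  have hA : ∀ ρ : ℝ, 0 < ρ → cknAEss ρ 0 u' = cknAEss (ρ * r) z u := fun ρ hρ => by
    rw [hu', cknAEss_nsZoom hr hρ z.1 z.2 0 u, hz, mul_comm]
  have hE : ∀ ρ : ℝ, 0 < ρ → cknE ρ 0 G' = cknE (ρ * r) z G := fun ρ hρ => by
    rw [hG', cknE_nsZoom hr hρ z.1 z.2 0 G, hz, mul_comm]
  have hC : cknC 1 0 u' = cknC r z u := by
    rw [hu', cknC_nsZoom hr one_pos z.1 z.2 0 u, hz, mul_one]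
  have hD : cknD 1 0 p' = cknD r z p := by
    rw [hp', cknD_nsZoom hr one_pos z.1 z.2 0 p, hz, mul_one]
  have hF : cknF q 1 0 f' = cknF q r z f := by
    rw [hf', cknF_nsZoom hr one_pos hq0 z.1 z.2 0 f, hz, mul_one]
  have hA1 : cknAEss 1 0 u' = cknAEss r z u := by rw [hA 1 one_pos, one_mul]
  have hE1 : cknE 1 0 G' = cknE r z G := by rw [hE 1 one_pos, one_mul]
  rw [hA θ hθ, hE θ hθ, hA1, hE1, hC, hD, hF] at key
  exact key

/-! ### Cylinders touching the top of the domain -/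

/-- **The local energy estimate in product form for cylinders `Q_R(z) ⊆ Q` (possibly touching the
top of `Q`), at the ratio `1/2`.** There are constants `k₁, k₂, k₃` such that for every suitable
weak solution `(u, p)` of the unforced Navier–Stokes equations (`ν = 1`) on an open
`Q ⊆ ℝ × ℝ³`, every weak spatial gradient `G` of `u` on `Q` and every backward cylinder with
`Q_R(z) ⊆ Q`,
`A(R/2; z) + E(R/2; z) ≤ k₁ C(R; z)^{2/3} + k₂ (A(R; z) E(R; z))^{1/2} C(R; z)^{1/3}
  + k₃ D(R; z)^{2/3} C(R; z)^{1/3}` (`A = cknAEss`, `E = cknE`, `C = cknC`, `D = cknD`).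
From `localEnergyProduct` on the inner cylinders of `CKNInnerCylinders.lean` and the exhaustion
of `Q_{R/2}(z)` by windows (Tsai 1998, remark after Lemma 4.2), as in `localEnergyBound_top`.
[cite: Seregin2014, Lemma 6.3 (6.1.36); Tsai1998 remark after Lemma 4.2 (p. 46)] -/
theorem localEnergyProduct_top :
    ∃ k₁ k₂ k₃ : ℝ≥0, ∀ (Q : Opens (ℝ × EuclideanSpace ℝ (Fin 3)))
      (u : ℝ → EuclideanSpace ℝ (Fin 3) → EuclideanSpace ℝ (Fin 3))
      (p : ℝ → EuclideanSpace ℝ (Fin 3) → ℝ)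
      (G : ℝ → EuclideanSpace ℝ (Fin 3) → EuclideanSpace ℝ (Fin 3) →L[ℝ] EuclideanSpace ℝ (Fin 3)),
      IsSuitableWeakSolutionOn Q 1 0 u p → HasWeakSpatialGradientOn Q u G →
      ∀ (z : ℝ × EuclideanSpace ℝ (Fin 3)) (R : ℝ), 0 < R →
        parabolicCylinder R z ⊆ (Q : Set (ℝ × EuclideanSpace ℝ (Fin 3))) →
        cknAEss (R / 2) z u + cknE (R / 2) z G ≤
          k₁ * cknC R z u ^ (2 / 3 : ℝ) +
          k₂ * ((cknAEss R z u * cknE R z G) ^ (1 / 2 : ℝ) * cknC R z u ^ (1 / 3 : ℝ)) +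
          k₃ * (cknD R z p ^ (2 / 3 : ℝ) * cknC R z u ^ (1 / 3 : ℝ)) := by
  obtain ⟨k₁, k₂, k₃, k₄, H⟩ := localEnergyProduct
  refine ⟨2 * (k₁ * 4), 2 * (k₂ * 64), 2 * (k₃ * 64), fun Q u p G hsw hG z R hR hQ => ?_⟩
  obtain ⟨σ, hσh, hσ0, hσ1, hσm, hσt⟩ := exists_innerScales_half
  set C := cknC R z u with hC
  set D := cknD R z p with hD
  set A := cknAEss R z u with hA
  set EE := cknE R z G with hEE
  set K : ℝ≥0∞ := (k₁ * 4 : ℝ≥0) * C ^ (2 / 3 : ℝ) +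
    (k₂ * 64 : ℝ≥0) * ((A * EE) ^ (1 / 2 : ℝ) * C ^ (1 / 3 : ℝ)) +
    (k₃ * 64 : ℝ≥0) * (D ^ (2 / 3 : ℝ) * C ^ (1 / 3 : ℝ)) with hK
  have hθ : (0 : ℝ) < 2⁻¹ := by norm_num
  have hθ2 : ((2 : ℝ)⁻¹) ^ 2 ≤ 1 / 2 := by norm_num
  -- ### Step 1: the bound on the inner cylinders, uniformly in `n`
  have inner : ∀ n : ℕ,
      cknAEss (2⁻¹ * (σ n * R)) (z.1 - (R ^ 2 - (σ n * R) ^ 2) / 2, z.2) u +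
        cknE (2⁻¹ * (σ n * R)) (z.1 - (R ^ 2 - (σ n * R) ^ 2) / 2, z.2) G ≤ K := by
    intro n
    set r' := σ n * R with hr'
    set z' : ℝ × EuclideanSpace ℝ (Fin 3) := (z.1 - (R ^ 2 - r' ^ 2) / 2, z.2) with hz'
    have hr'0 : 0 < r' := mul_pos (hσ0 n) hR
    have hr'R : r' < R := by
      have := hσ1 n
      have : σ n * R < 1 * R := mul_lt_mul_of_pos_right this hR
      simpa [hr'] using this
    have hcl : closure (parabolicCylinder r' z') ⊆ (Q : Set (ℝ × EuclideanSpace ℝ (Fin 3))) :=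
      (closure_parabolicCylinder_inner_subset hr'0 hr'R z).trans hQ
    have hsub : parabolicCylinder r' z' ⊆ parabolicCylinder R z :=
      parabolicCylinder_inner_subset hr'0 hr'R z
    have hf0 : MemLp (uncurry (0 : ℝ → EuclideanSpace ℝ (Fin 3) → EuclideanSpace ℝ (Fin 3)))
        (ENNReal.ofReal 3) (volume.restrict (Q : Set (ℝ × EuclideanSpace ℝ (Fin 3)))) :=
      MemLp.zero
    have key := H Q 3 0 u p G hsw (by norm_num) hf0 hG z' r' 2⁻¹ hr'0 hθ (by norm_num) hcl
    -- the data of the inner cylinder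
    have hratio1 : ENNReal.ofReal (R / r') ≤ 2 := by
      have h1 : R / r' ≤ 2 := by
        rw [div_le_iff₀ hr'0, hr']
        have := hσh n
        nlinarith
      calc ENNReal.ofReal (R / r') ≤ ENNReal.ofReal 2 := ENNReal.ofReal_le_ofReal h1
        _ = 2 := ENNReal.ofReal_ofNat 2
    have hratio : ENNReal.ofReal (R / r') ^ 2 ≤ 4 := by
      calc ENNReal.ofReal (R / r') ^ 2 ≤ 2 ^ 2 := by gcongr
        _ = 4 := by norm_num
    have hC' : cknC r' z' u ≤ 4 * C :=
      (cknC_le_mul_of_subset hR hr'0 hsub u).trans (mul_le_mul_left hratio _)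
    have hD' : cknD r' z' p ≤ 4 * D :=
      (cknD_le_mul_of_subset hR hr'0 hsub p).trans (mul_le_mul_left hratio _)
    have hE' : cknE r' z' G ≤ 2 * EE :=
      (cknE_le_mul_of_subset hR hr'0 hsub G).trans (mul_le_mul_left hratio1 _)
    have hA' : cknAEss r' z' u ≤ 2 * A := by
      have hI : Ioo (z'.1 - r' ^ 2) z'.1 ⊆ Ioo (z.1 - R ^ 2) z.1 := Ioo_inner_subset hr'0 hr'R z.1
      have hB : ball z'.2 r' ⊆ ball z.2 R := ball_subset_ball hr'R.le
      exact (cknAEss_le_mul_of_subset hR hr'0 hI hB u).trans (mul_le_mul_left hratio1 _)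
    have hAE' : (cknAEss r' z' u * cknE r' z' G) ^ (1 / 2 : ℝ) ≤ 4 * (A * EE) ^ (1 / 2 : ℝ) := by
      calc (cknAEss r' z' u * cknE r' z' G) ^ (1 / 2 : ℝ) ≤ (2 * A * (2 * EE)) ^ (1 / 2 : ℝ) := by
            gcongr
        _ = (4 * (A * EE)) ^ (1 / 2 : ℝ) := by congr 1; ring
        _ ≤ 4 * (A * EE) ^ (1 / 2 : ℝ) := rpow_four_mul_le _ (by norm_num) (by norm_num)
    have hF : cknF 3 r' z' (0 : ℝ → EuclideanSpace ℝ (Fin 3) → EuclideanSpace ℝ (Fin 3)) = 0 := by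
      simp [cknF, ENNReal.zero_rpow_of_pos (show (0 : ℝ) < 3 by norm_num)]
    have e4 : ENNReal.ofReal (((2 : ℝ)⁻¹ ^ 2)⁻¹) = 4 := by norm_num
    refine key.trans ?_
    rw [hF, ENNReal.zero_rpow_of_pos (by norm_num), mul_zero, zero_mul, add_zero, e4]
    -- term by term
    have t1 : (k₁ : ℝ≥0∞) * ENNReal.ofReal ((2 : ℝ)⁻¹ ^ 2) * cknC r' z' u ^ (2 / 3 : ℝ) ≤
        (k₁ * 4 : ℝ≥0) * C ^ (2 / 3 : ℝ) := by
      have e1 : ENNReal.ofReal ((2 : ℝ)⁻¹ ^ 2) ≤ 1 := by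
        rw [← ENNReal.ofReal_one]; exact ENNReal.ofReal_le_ofReal (by norm_num)
      calc (k₁ : ℝ≥0∞) * ENNReal.ofReal ((2 : ℝ)⁻¹ ^ 2) * cknC r' z' u ^ (2 / 3 : ℝ)
          ≤ k₁ * 1 * (4 * C) ^ (2 / 3 : ℝ) := by gcongr
        _ ≤ k₁ * 1 * (4 * C ^ (2 / 3 : ℝ)) := by
            gcongr; exact rpow_four_mul_le C (by norm_num) (by norm_num)
        _ = (k₁ * 4 : ℝ≥0) * C ^ (2 / 3 : ℝ) := by push_cast; ring
    have t2 : (k₂ : ℝ≥0∞) * 4 * (cknAEss r' z' u * cknE r' z' G) ^ (1 / 2 : ℝ) *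
        cknC r' z' u ^ (1 / 3 : ℝ) ≤ (k₂ * 64 : ℝ≥0) * ((A * EE) ^ (1 / 2 : ℝ) * C ^ (1 / 3 : ℝ)) := by
      calc (k₂ : ℝ≥0∞) * 4 * (cknAEss r' z' u * cknE r' z' G) ^ (1 / 2 : ℝ) *
            cknC r' z' u ^ (1 / 3 : ℝ)
          ≤ k₂ * 4 * (4 * (A * EE) ^ (1 / 2 : ℝ)) * (4 * C) ^ (1 / 3 : ℝ) := by gcongr
        _ ≤ k₂ * 4 * (4 * (A * EE) ^ (1 / 2 : ℝ)) * (4 * C ^ (1 / 3 : ℝ)) := by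
            gcongr; exact rpow_four_mul_le C (by norm_num) (by norm_num)
        _ = (k₂ * 64 : ℝ≥0) * ((A * EE) ^ (1 / 2 : ℝ) * C ^ (1 / 3 : ℝ)) := by push_cast; ring
    have t3 : (k₃ : ℝ≥0∞) * 4 * cknD r' z' p ^ (2 / 3 : ℝ) * cknC r' z' u ^ (1 / 3 : ℝ) ≤
        (k₃ * 64 : ℝ≥0) * (D ^ (2 / 3 : ℝ) * C ^ (1 / 3 : ℝ)) := by
      calc (k₃ : ℝ≥0∞) * 4 * cknD r' z' p ^ (2 / 3 : ℝ) * cknC r' z' u ^ (1 / 3 : ℝ)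
          ≤ k₃ * 4 * (4 * D) ^ (2 / 3 : ℝ) * (4 * C) ^ (1 / 3 : ℝ) := by gcongr
        _ ≤ k₃ * 4 * (4 * D ^ (2 / 3 : ℝ)) * (4 * C ^ (1 / 3 : ℝ)) := by
            gcongr
            · exact rpow_four_mul_le D (by norm_num) (by norm_num)
            · exact rpow_four_mul_le C (by norm_num) (by norm_num)
        _ = (k₃ * 64 : ℝ≥0) * (D ^ (2 / 3 : ℝ) * C ^ (1 / 3 : ℝ)) := by push_cast; ring
    calc _ ≤ _ := add_le_add (add_le_add t1 t2) t3
      _ = K := by rw [hK]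
  -- ### Step 2: the dissipation at the top by exhaustion
  have hE : cknE (2⁻¹ * R) z G ≤ K := by
    rw [cknE, ← iSup_window_lintegral hσ0 hσ1 hσm hσt hR hθ z volume
      (fun w => ENNReal.ofReal (frobeniusNormSq (G w.1 w.2))), ENNReal.mul_iSup]
    refine iSup_le fun n => ?_
    have hle : σ n * R ≤ R := by
      have := hσ1 n
      have : σ n * R < 1 * R := mul_lt_mul_of_pos_right this hR
      exact le_of_lt (by simpa using this)
    have hV := window_subset_parabolicCylinder_inner hθ2 hle (mul_pos (hσ0 n) hR).le z
    exact (window_lintegral_le_cknE hθ hle hV G).trans (le_add_self.trans (inner n))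
  -- ### Step 3: the energy at the top by exhaustion
  have hAt : cknAEss (2⁻¹ * R) z u ≤ K := by
    refine (cknAEss_le_iSup_window hσ1 hσm hσt hR hθ z u).trans (iSup_le fun n => ?_)
    have hle : σ n * R ≤ R := by
      have := hσ1 n
      have : σ n * R < 1 * R := mul_lt_mul_of_pos_right this hR
      exact le_of_lt (by simpa using this)
    have hI := Ioo_window_subset hθ2 hle (mul_pos (hσ0 n) hR).le z.1 (θ := 2⁻¹)
    exact (window_essSup_le_cknAEss hθ hle hI u).trans (le_self_add.trans (inner n))
  -- ### Conclusion
  have h2 : R / 2 = 2⁻¹ * R := by ring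
  rw [h2]
  calc cknAEss (2⁻¹ * R) z u + cknE (2⁻¹ * R) z G ≤ K + K := add_le_add hAt hE
    _ = _ := by rw [hK]; push_cast; ring

end Seregin2020

end Literature.Analysis.FluidPDE
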